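import Summits.BirchSwinnertonDyer.Rank1Residual.X5.TwoAdicTargetsSplitEndAlpha
import Literature.NumberTheory.EllipticCurves.PAdicLFunctionIntegralityAtTwoSplitMultProofs
import HarnessLib

/-!
# Class O1 (X5, `p = 2`, non-CM): the split-`2` END-STATE with the integrality certificate `hint`
# DISCHARGED (INT2-AUTO-sp) — per pair the inputs are PRINT + K11b-Rat + `hκ₁` + `0 ≤ ord₂ ϖ` + `hlow`

HONEST FRAMING (cell `b2b-bsdres`, run/shared/lean/b2b/bsd-rank1-residual/, verbatim in every
file): the goal of the cell is to DELETE the COMBINATION-SHAPED residual classes of the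
Birch–Swinnerton-Dyer formula for ALL analytic-rank `≤ 1` elliptic curves over `ℚ` — "full BSD
formula for every rank `≤ 1` curve in class `C`" assembled STRICTLY from published theorems — so
that the rank-`≤ 1` remainder becomes exactly the CONSTRUCTION-SHAPED classes, which are TYPED
(missing-input `Prop`s), NOT attempted. This is not "finishing BSD". Research routes; no claim
beyond stated classes; census output = EVIDENCE, never a Literature fact; nothing here is booked;
no mark of RESIDUAL-MAP §I moves.

Unit `b2b-bsdres-cc-typer-4` (lane CLASS-CLOSURE, class O1), gen 4 — the split twin of
`X5/TwoAdicTargetsAlphaAuto.lean`. Theorems only; 0 typed targets, 0 named facts. INT2-AUTO-sp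
(`Literature/…/PAdicLFunctionIntegralityAtTwoSplitMultProofs.lean`, this seat:
`exists_iwasawaToPowerSeries_eq_of_isSplitMultPAdicLFunctionOf_two` — `L₂(E,T) ∈ Λ` for EVERY curve
split multiplicative at `2`, no `E[2]` / image / Manin hypothesis) turns the per-curve certificate
`hint : ∃ L₀, ι L₀ = ϖ · L` of the split consumers (`X5/TwoAdicTargetsSplitEndAlpha.lean`) into the single
inequality `0 ≤ ord₂ ϖ` on the period ratio `ϖ = Ω⁺_f/Ω_W` of the newform at level `N_E`
(`hper₀`, as on the α-go line; EVIDENCE: lens-1's period census; in print per optimal curve via the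
Manin constant at `2 ∥ N` — Česnavičius 2018 — plus the lattice index inside the isogeny class,
locator ask L-11 of the o1 lead).

* `exists_integral_mul_of_isSplitMultPAdicLFunctionOf_two_of_padicValRat_nonneg` — `0 ≤ ord₂ ϖ` ⇒
  `∃ L₀ : Λ, ι L₀ = ϖ · L` (PROVED).
* `missingUpperBoundAt_two_split_of_mu_eq_zero_auto`, `missingUpperBoundAt_two_split_of_prop514_auto`,
  **`bsdp_two_split_of_prop514_of_lowerBound_auto`** (PROVED) — the α-sp END-STATE per pair:
  `BSDp W 2` ⟸ PRINT {Prop. 5.14 at `2` (`h514`), Greenberg's split display at `2` (A236, `h41`),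
  modularity, GZK, Tate V.5.3, Mahler–Manin} + K11b-Rat (`hK`, NOT in print, AUDIT S–M) + the decidable
  5.14 data (`hP`, `h2`, `hΦ`) + `hκ₁` (κ₁-certificate, EVIDENCE 554/554) + `hper₀` + `hlow`.
References: [MazurTateTeitelbaum1986Invent] §I.10, §I.12–13; [GreenbergLNM1716] §4 pp. 112–113,
Prop. 5.14; [Miller2011LMS] Def. 1.1; [Cesnavicius2018] (Manin constant at 2 ∥ N; locator pending).
-/

set_option autoImplicit false

noncomputable section

open scoped Classical MatrixGroups ModularForm

open CongruenceSubgroup WeierstrassCurve Literature.NumberTheory.EllipticCurves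
  Literature.NumberTheory.EllipticCurves.ModularForms
  Literature.NumberTheory.EllipticCurves.Greenberg1999
  Literature.NumberTheory.EllipticCurves.Rank1Residual
  Literature.NumberTheory.EllipticCurves.Rank1Residual.Typed

namespace Summit.BirchSwinnertonDyer.Rank1Residual.X5.O1

variable (W : WeierstrassCurve ℚ) [W.IsElliptic] [W.IsGloballyMinimal]

/-! ## §1 INT2-AUTO-sp ⇒ the certificate `ι L₀ = ϖ · L` from `0 ≤ ord₂ ϖ` -/

omit [W.IsGloballyMinimal] in
/-- **The Néron-integrality certificate at a split `2` from one inequality (PROVED).** `E = W` split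
multiplicative at `2`, `f` its newform (any level), `L` with `IsSplitMultPAdicLFunctionOf f 2 L`,
`ϖ ∈ ℚ` with `0 ≤ ord₂ ϖ`: `∃ L₀ : Λ, ι L₀ = ϖ · L` — `L = ι G` unconditionally (INT2-AUTO-sp,
`exists_iwasawaToPowerSeries_eq_of_isSplitMultPAdicLFunctionOf_two`) and `ϖ ∈ ℤ₂`, so `L₀ = ϖ G`.
[cite: MazurTateTeitelbaum1986Invent, §I.12] -/
theorem exists_integral_mul_of_isSplitMultPAdicLFunctionOf_two_of_padicValRat_nonneg
    (hsp : W.HasSplitMultiplicativeReductionAtPrime 2)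
    {N : ℕ} [NeZero N] {f : CuspForm (Gamma0 N) 2} (hf : IsNewformOf W f)
    {L : PowerSeries ℚ_[2]} (hL : IsSplitMultPAdicLFunctionOf f 2 L) {ϖ : ℚ}
    (hϖ : 0 ≤ padicValRat 2 ϖ) :
    ∃ L₀ : IwasawaAlgebra 2, iwasawaToPowerSeries 2 L₀ = PowerSeries.C (ϖ : ℚ_[2]) * L := by
  obtain ⟨G, hG⟩ := exists_iwasawaToPowerSeries_eq_of_isSplitMultPAdicLFunctionOf_two hsp hf hL
  have hnorm : ‖((ϖ : ℚ) : ℚ_[2])‖ ≤ 1 := by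
    by_cases h0 : ϖ = 0
    · subst h0; simp
    have hϖQ : ((ϖ : ℚ) : ℚ_[2]) ≠ 0 := by exact_mod_cast h0
    rw [Padic.norm_eq_zpow_neg_valuation hϖQ, Padic.valuation_ratCast]
    exact zpow_le_one_of_nonpos₀ (by norm_num) (by linarith)
  let ϖ₀ : ℤ_[2] := ⟨((ϖ : ℚ) : ℚ_[2]), hnorm⟩
  refine ⟨(PowerSeries.C ϖ₀ : IwasawaAlgebra 2) * G, ?_⟩
  rw [map_mul, hG, iwasawaToPowerSeries, PowerSeries.map_C]
  rfl

/-! ## §2 The split END-STATE with `hint` discharged -/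

/-- **Lens-3 S6 with the integrality certificate discharged (PROVED).** As
`missingUpperBoundAt_two_split_of_mu_eq_zero` (analytic rank `0`, split multiplicative `2`; S2 `hEC`,
modularity, GZK; K11b-Rat `hK`; `μ = 0` for the cyclotomic data `hμ`; the `κ₁`-certificate `hκ₁`), with
`hint` replaced by `hper₀ : 0 ≤ ord₂ ϖ` for the period ratios of the newform at level `N_E`
(INT2-AUTO-sp). [cite: MazurTateTeitelbaum1986Invent, §I.12] [cite: Miller2011LMS, Def. 1.1]
[cite: GreenbergLNM1716, §4 pp. 112–113] -/
theorem missingUpperBoundAt_two_split_of_mu_eq_zero_auto (hEC : TwoAdicEulerCharRankZeroSplitMult W 0)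
    (hmod : nonempty_modularParametrizationData)
    (hGZK : rank_eq_analyticRank_of_analyticRank_le_one)
    (hK : ∀ [NeZero (W.conductorNorm ℤ)] (f : CuspForm (Gamma0 (W.conductorNorm ℤ)) 2)
      (L : PowerSeries ℚ_[2]), KatoDivisibilityAtTwoSplitMultRat W f L)
    (hμ : ∀ (κ : ZpExtension ℚ 2) (γ : Field.absoluteGaloisGroup ℚ), κ.IsCyclotomic →
      κ.IsTopGenerator γ → IsCyclotomicVariable 2 γ → ∀ D : W.SelmerDualData κ γ, D.mu = 0)
    (hκ₁ : ∀ [NeZero (W.conductorNorm ℤ)] (f : CuspForm (Gamma0 (W.conductorNorm ℤ)) 2),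
      IsNewformOf W f → ∀ L : PowerSeries ℚ_[2], IsSplitMultPAdicLFunctionOf f 2 L →
      ∀ Dq : TateParameterData W 2, PowerSeries.coeff 1 L ≠ 0 ∧
        (PowerSeries.coeff 1 L).valuation ≤
          padicValRat 2 (ratPlusSymbol f 0) + ((LInvariant Dq).valuation - 2))
    (hper₀ : ∀ [NeZero (W.conductorNorm ℤ)] (f : CuspForm (Gamma0 (W.conductorNorm ℤ)) 2),
      IsNewformOf W f → ∀ ϖ : ℚ, (ϖ : ℝ) * W.realPeriodRat = plusPeriod f → 0 ≤ padicValRat 2 ϖ)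
    (hr : W.analyticRank = 0) (hmult : Mult W 2)
    (hsp : W.HasSplitMultiplicativeReductionAtPrime 2) : MissingUpperBoundAt W 2 :=
  missingUpperBoundAt_two_split_of_mu_eq_zero W hEC hmod hGZK hK hμ
    (fun f hf ϖ hϖ _ hL =>
      exists_integral_mul_of_isSplitMultPAdicLFunctionOf_two_of_padicValRat_nonneg W hsp hf hL
        (hper₀ f hf ϖ hϖ))
    hκ₁ hr hmult hsp

/-- **L3-13α with the integrality certificate discharged (PROVED):** `MissingUpperBoundAt W 2` on the
Prop. 5.14 locus at a split `2` from PRINT {5.14@2 `h514`, S2 `hEC`, modularity, GZK} + K11b-Rat +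
`hκ₁` + `hper₀`. [cite: GreenbergLNM1716, Prop. 5.14 (p. 121) and §4 pp. 112–113]
[cite: MazurTateTeitelbaum1986Invent, §I.12] [cite: Miller2011LMS, Def. 1.1] -/
theorem missingUpperBoundAt_two_split_of_prop514_auto (h514 : prop514_isTorsion_mu_eq_zero_two)
    (hEC : TwoAdicEulerCharRankZeroSplitMult W 0) (hmod : nonempty_modularParametrizationData)
    (hGZK : rank_eq_analyticRank_of_analyticRank_le_one)
    (hK : ∀ [NeZero (W.conductorNorm ℤ)] (f : CuspForm (Gamma0 (W.conductorNorm ℤ)) 2)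
      (L : PowerSeries ℚ_[2]), KatoDivisibilityAtTwoSplitMultRat W f L)
    (hκ₁ : ∀ [NeZero (W.conductorNorm ℤ)] (f : CuspForm (Gamma0 (W.conductorNorm ℤ)) 2),
      IsNewformOf W f → ∀ L : PowerSeries ℚ_[2], IsSplitMultPAdicLFunctionOf f 2 L →
      ∀ Dq : TateParameterData W 2, PowerSeries.coeff 1 L ≠ 0 ∧
        (PowerSeries.coeff 1 L).valuation ≤
          padicValRat 2 (ratPlusSymbol f 0) + ((LInvariant Dq).valuation - 2))
    (hper₀ : ∀ [NeZero (W.conductorNorm ℤ)] (f : CuspForm (Gamma0 (W.conductorNorm ℤ)) 2),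
      IsNewformOf W f → ∀ ϖ : ℚ, (ϖ : ℝ) * W.realPeriodRat = plusPeriod f → 0 ≤ padicValRat 2 ϖ)
    (hr : W.analyticRank = 0) (hmult : Mult W 2) (hsp : W.HasSplitMultiplicativeReductionAtPrime 2)
    {x y : ℚ} (hP : W.toAffine.Equation x y) (h2 : 2 * y + W.a₁ * x + W.a₃ = 0)
    (hΦ : (TwoTorsionRamifiedAtTwo x ∧ ¬ TwoTorsionOdd W x) ∨
      (TwoTorsionOdd W x ∧ ¬ TwoTorsionRamifiedAtTwo x)) : MissingUpperBoundAt W 2 :=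
  missingUpperBoundAt_two_split_of_mu_eq_zero_auto W hEC hmod hGZK hK
    (fun _ _ hκ hγ _ D => (h514.of_mult W hmult hP h2 hΦ hκ hγ D).2) hκ₁ hper₀ hr hmult hsp

/-- **α-sp END-STATE per pair with the control slot PUBLISHED and the integrality certificate
DISCHARGED: `BSD(E,2)` on the Prop. 5.14 locus at a split multiplicative `2` from the lower half
(PROVED).** Per pair the inputs are PRINT {Prop. 5.14 at `2` (`h514`), Greenberg's split display at
`2` (`h41`, A236), modularity (`hmod`), GZK (`hGZK`), Tate V.5.3 and Mahler–Manin (inside)} + K11b-Rat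
(`hK`, NOT in print; price AUDIT S–M) + the decidable 5.14 data (`hP`, `h2`, `hΦ`) + three per-pair
inputs {`hκ₁` (the κ₁-certificate), `hper₀` (`0 ≤ ord₂(Ω⁺_f/Ω_W)`), `hlow` (`MissingLowerBoundAt W 2`)}.
One member per isogeny class suffices (`bsdp_two_iff_of_isIsogenous`). Nothing is booked.
[cite: GreenbergLNM1716, Prop. 5.14 (p. 121) and §4 pp. 112–113] [cite: Miller2011LMS, Def. 1.1 and §1]
[cite: MazurTateTeitelbaum1986Invent, §I.12] -/
theorem bsdp_two_split_of_prop514_of_lowerBound_auto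
    (h514 : prop514_isTorsion_mu_eq_zero_two)
    (h41 : thm41Analogue_charValue_rankZero_split_baseChange_anyPrime)
    (hmod : nonempty_modularParametrizationData)
    (hGZK : rank_eq_analyticRank_of_analyticRank_le_one)
    (hK : ∀ [NeZero (W.conductorNorm ℤ)] (f : CuspForm (Gamma0 (W.conductorNorm ℤ)) 2)
      (L : PowerSeries ℚ_[2]), KatoDivisibilityAtTwoSplitMultRat W f L)
    (hκ₁ : ∀ [NeZero (W.conductorNorm ℤ)] (f : CuspForm (Gamma0 (W.conductorNorm ℤ)) 2),
      IsNewformOf W f → ∀ L : PowerSeries ℚ_[2], IsSplitMultPAdicLFunctionOf f 2 L →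
      ∀ Dq : TateParameterData W 2, PowerSeries.coeff 1 L ≠ 0 ∧
        (PowerSeries.coeff 1 L).valuation ≤
          padicValRat 2 (ratPlusSymbol f 0) + ((LInvariant Dq).valuation - 2))
    (hper₀ : ∀ [NeZero (W.conductorNorm ℤ)] (f : CuspForm (Gamma0 (W.conductorNorm ℤ)) 2),
      IsNewformOf W f → ∀ ϖ : ℚ, (ϖ : ℝ) * W.realPeriodRat = plusPeriod f → 0 ≤ padicValRat 2 ϖ)
    (hr : W.analyticRank = 0) (hmult : Mult W 2) (hsp : W.HasSplitMultiplicativeReductionAtPrime 2)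
    {x y : ℚ} (hP : W.toAffine.Equation x y) (h2 : 2 * y + W.a₁ * x + W.a₃ = 0)
    (hΦ : (TwoTorsionRamifiedAtTwo x ∧ ¬ TwoTorsionOdd W x) ∨
      (TwoTorsionOdd W x ∧ ¬ TwoTorsionRamifiedAtTwo x))
    (hlow : MissingLowerBoundAt W 2) : BSDp W 2 :=
  bsdp_of_missingPPartAt W 2 hGZK (by rw [hr]; exact zero_le_one)
    (missingPPartAt_of_lower_of_upper W 2 hlow
      (missingUpperBoundAt_two_split_of_prop514_auto W h514
        (twoAdicEulerCharRankZeroSplitMult_zero_of_greenberg W h41) hmod hGZK hK hκ₁ hper₀ hr hmult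
        hsp hP h2 hΦ))

/-- **The general split END-STATE per pair from a `μ = 0` certificate (e.g. a tower gap), control slot
PUBLISHED and `hint` DISCHARGED (PROVED):** `BSDp W 2` ⟸ PRINT {A236 `h41`, modularity, GZK} +
K11b-Rat + `hμ` + `hκ₁` + `hper₀` + `hlow`. The O1-A-sp line (567 classes: E[2] irreducible, where
Prop. 5.14 does not apply and `hμ` is the T10 tower-gap certificate). [cite: Miller2011LMS, Def. 1.1 and §1]
[cite: GreenbergLNM1716, §4 pp. 112–113] [cite: MazurTateTeitelbaum1986Invent, §I.12] -/
theorem bsdp_two_split_of_mu_eq_zero_of_lowerBound_auto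
    (h41 : thm41Analogue_charValue_rankZero_split_baseChange_anyPrime)
    (hmod : nonempty_modularParametrizationData)
    (hGZK : rank_eq_analyticRank_of_analyticRank_le_one)
    (hK : ∀ [NeZero (W.conductorNorm ℤ)] (f : CuspForm (Gamma0 (W.conductorNorm ℤ)) 2)
      (L : PowerSeries ℚ_[2]), KatoDivisibilityAtTwoSplitMultRat W f L)
    (hμ : ∀ (κ : ZpExtension ℚ 2) (γ : Field.absoluteGaloisGroup ℚ), κ.IsCyclotomic →
      κ.IsTopGenerator γ → IsCyclotomicVariable 2 γ → ∀ D : W.SelmerDualData κ γ, D.mu = 0)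
    (hκ₁ : ∀ [NeZero (W.conductorNorm ℤ)] (f : CuspForm (Gamma0 (W.conductorNorm ℤ)) 2),
      IsNewformOf W f → ∀ L : PowerSeries ℚ_[2], IsSplitMultPAdicLFunctionOf f 2 L →
      ∀ Dq : TateParameterData W 2, PowerSeries.coeff 1 L ≠ 0 ∧
        (PowerSeries.coeff 1 L).valuation ≤
          padicValRat 2 (ratPlusSymbol f 0) + ((LInvariant Dq).valuation - 2))
    (hper₀ : ∀ [NeZero (W.conductorNorm ℤ)] (f : CuspForm (Gamma0 (W.conductorNorm ℤ)) 2),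
      IsNewformOf W f → ∀ ϖ : ℚ, (ϖ : ℝ) * W.realPeriodRat = plusPeriod f → 0 ≤ padicValRat 2 ϖ)
    (hr : W.analyticRank = 0) (hmult : Mult W 2) (hsp : W.HasSplitMultiplicativeReductionAtPrime 2)
    (hlow : MissingLowerBoundAt W 2) : BSDp W 2 :=
  bsdp_of_missingPPartAt W 2 hGZK (by rw [hr]; exact zero_le_one)
    (missingPPartAt_of_lower_of_upper W 2 hlow
      (missingUpperBoundAt_two_split_of_mu_eq_zero_auto W
        (twoAdicEulerCharRankZeroSplitMult_zero_of_greenberg W h41) hmod hGZK hK hμ hκ₁ hper₀ hr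
        hmult hsp))

end Summit.BirchSwinnertonDyer.Rank1Residual.X5.O1

end
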